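import Summits.QuantumFields.BalabanUV.Beta.GraphPoissonKernel

/-!
# `Summit.QuantumFields.BalabanUV.Beta.MeanValueFromPoisson` — the L¹ MEAN-VALUE BINDER (MV) FROM ONE POINTWISE POISSON-KERNEL BOUND,
# by domination on each ball and averaging over the radii, for ANY integer-valued radius function that is 1-Lipschitz along the bonds
# (generic finite bond structure; no lattice geometry) — step 2 of road P3's reduction of O.2 item (ii-b)'s residual binder

HONEST FRAMING (page 1 of everything in this cell).  Discharging `FlowStep.BetaPertH` would make Bałaban's ultraviolet
stability UNCONDITIONAL — a constructive-QFT result; it is NOT the continuum limit and NOT the Clay problem.  This module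
discharges nothing of `BetaPertH`; it is [folklore] order bookkeeping and finite sums on a finite bond structure, kernel-checked, by
CO-OWNER #3 of binder row D4 (unit `b2b-balaban-beta-d4-p3`, road P3 «reduction road», gen 12).  HONEST DEPENDENCY: continuum YM on T⁴ ⇐
BetaPertH ∧ nine spine estimates (0/9 proved); BetaPertH ⇐ (D1) ∧ (D4) ∧ CAP+tail; G-an2-4 gates asym, D1 and NE2/3/4.

THE POINT.  O.2 item (ii-b) for the MODEL is, after files 12∕14∕15a∕15b and this road's `SubsolutionMeanValue`, the binder (MV): «every
`z ≥ 0` with `W·z ≤ Nz` on the ball of radius `r` has `z(centre) ≤ C·r^{−d}·Σ_{ball} z`», `C` level-free.  THIS FILE proves (MV) from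
ONE POINTWISE BOUND on the Poisson kernel of `GraphPoissonKernel` — the harmonic-measure bound «`poisson (C_s) x y ≤ K₀/s^{d−1}` for
`y` outside the ball `C_s` of radius `s`», which for the simple nearest-neighbour weights on `ℤ^d` is a displayed lemma of the standard
texts (Lawler–Limic 2010, Lemma 6.3.7 p. 130: `H_{C_n}(x,y) ≤ c₂ n^{1−d}` for `x ∈ C_{n/4}`, `y ∈ ∂C_n`, their `H` being «the unique function
harmonic on `C_n` equal to `δ(· − y)` on `∂C_n`», ibid. p. 123 = the tree's `poisson`).  The argument is GENERIC: on any finite bond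
structure `src, tgt : Bd → St` with weights `c`, let `ρ : St → ℕ` be any «radius» that is 1-LIPSCHITZ ALONG THE BONDS
(`ρ(tgt b) ≤ ρ(src b) + 1`, `ρ(src b) ≤ ρ(tgt b) + 1` — e.g. `⌊|x − x₀|⌋` for the Euclidean, sup or graph distance on a lattice), with balls
`C_s = {ρ < s}`:
* §1 the exterior boundary of `C_s` lies in the LEVEL SET `{ρ = s}`: `poisson (C_s) x y = 0` for `x ∈ C_s` and `ρ y > s`
  (`poisson_ball_eq_zero_of_lt_level`, from `poisson_eq_zero_of_not_adj`);
* §2 **`le_mul_sum_level`** — domination on ONE ball: `z ≥ 0`, `W·z ≤ Nz` on `C_s`, `x ∈ C_s`, `poisson (C_s) x y ≤ K` on the level set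
  `{ρ = s}` ⟹ `z(x) ≤ K·Σ_{ρ = s} z`;
* §3 **`card_mul_le_sum_levels`** — AVERAGING over the radii `s ∈ [s₁, s₂]` (level sets are disjoint):
  `(s₂ + 1 − s₁)·z(x) ≤ Σ_{s=s₁}^{s₂} K_s·Σ_{ρ = s} z ≤ (max K)·Σ_{s₁ ≤ ρ ≤ s₂} z` (`…_le_max_mul_sum`);
* §4 **`meanValue_of_poisson_bound`** — THE BINDER'S SHAPE: with `K_s = K₀/s^{d−1}` on `s ∈ (s₂/2, s₂]` and `x` in all these balls,
  `z(x) ≤ 2^d·K₀/s₂^d · Σ_{ρ ≤ s₂} z` — the L¹ mean-value inequality at `x` with the level-free constant `2^d·K₀`, i.e. the `hMV` of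
  `SubsolutionMeanValue.subsolution_le_meanValue_unit` with `Φ(z) = (2^dK₀/s₂^d)·Σ_{ρ ≤ s₂} z` (restricted to sub-solutions on the
  larger set carrying the unit supersolution — the consumer's box).
So after this file the residual of (ii-b) for the MODEL with constant weights is EXACTLY the pointwise Poisson bound at the centre of
Euclidean lattice balls — ONE display line of print — plus the identification of the torus ball's Dirichlet problem with `ℤ^d`'s (no
wrap-around below half the period).  The bound itself is NOT proved here and is NOT asserted: it stays a HYPOTHESIS (`hP`) until a leaf
is typed and cross-read (ABSOLUTE RULE).

LOCATORS (shape only, nothing printed asserted; ABSOLUTE RULE): [Balaban1985BackgroundPropagators] Thm 3.1 (3.42) p. 397;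
[Balaban1983RegularityDecay] Lemma 2.2 (2.17) pp. 577–578 (print's own ℓ² → ℓ^∞ device); [Balaban1984PropagatorsII] Prop. 2.2 (2.67)
p. 234.  Row D4: NO class change (critical-path width 0; D4 DISCHARGE NO DATE); NOT BetaPertH, NOT continuum, NOT Clay, NOT summit progress.
-/

open scoped BigOperators
open Finset

namespace Summit.QuantumFields.BalabanUV.Beta.MeanValueFromPoisson

open Summit.QuantumFields.BalabanUV.Beta.GraphHarmonicExtension
open Summit.QuantumFields.BalabanUV.Beta.GraphPoissonKernel

noncomputable section

variable {St Bd : Type} [Fintype St] [Fintype Bd] [DecidableEq St] (src tgt : Bd → St) (c : Bd → ℝ)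
  (ρ : St → ℕ) (hρ : ∀ b, ρ (tgt b) ≤ ρ (src b) + 1 ∧ ρ (src b) ≤ ρ (tgt b) + 1)

/-! ## §1 The exterior boundary of a ball lies in the level set -/

section Level

variable (s : ℕ) (w₀ : St → ℝ) (hw₀0 : ∀ y, 0 ≤ w₀ y)
    (hw₀ : ∀ x ∈ univ.filter (fun y => ρ y < s),
      1 + ((∑ b ∈ univ.filter (fun b => tgt b = x), c b ^ 2 * w₀ (src b)) +
        ∑ b ∈ univ.filter (fun b => src b = x), c b ^ 2 * w₀ (tgt b)) ≤
      ((∑ b ∈ univ.filter (fun b => tgt b = x), c b ^ 2) + ∑ b ∈ univ.filter (fun b => src b = x), c b ^ 2) * w₀ x)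

include hρ hw₀0 hw₀

/-- **The Poisson kernel of the ball `C_s = {ρ < s}` vanishes beyond the level set `{ρ = s}`**: for `x ∈ C_s` and `ρ y > s` no bond
joins `y` to `C_s` (the radius is 1-Lipschitz along bonds), so `poisson (C_s) x y = 0`. [folklore] -/
theorem poisson_ball_eq_zero_of_lt_level (x y : St) (hx : ρ x < s) (hy : s < ρ y) :
    poisson src tgt c (univ.filter (fun y => ρ y < s)) x y = 0 := by
  refine poisson_eq_zero_of_not_adj src tgt c _ w₀ hw₀0 hw₀ x y (mem_filter.mpr ⟨mem_univ _, hx⟩)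
    (fun h => by have := (mem_filter.mp h).2; omega) (fun b => ⟨?_, ?_⟩)
  · rintro ⟨hb, rfl⟩
    have h1 := (mem_filter.mp hb).2
    have h2 := (hρ b).1
    omega
  · rintro ⟨hb, rfl⟩
    have h1 := (mem_filter.mp hb).2
    have h2 := (hρ b).2
    omega

/-! ## §2 Domination on one ball by the level-set sum -/

/-- **DOMINATION ON ONE BALL.**  Let `z ≥ 0` satisfy `W·z ≤ Nz` on `C_s = {ρ < s}`, let `x ∈ C_s`, and let the Poisson kernel of `C_s`
from `x` be bounded by `K` on the level set `{ρ = s}`.  Then `z(x) ≤ K·Σ_{ρ = s} z` (domination by the Poisson integral of the exterior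
values, `GraphPoissonKernel.subsolution_le_poisson_sum`; the kernel vanishes beyond the level set, §1). [folklore] -/
theorem le_mul_sum_level (z : St → ℝ) (hz0 : ∀ y, 0 ≤ z y)
    (hz : ∀ x ∈ univ.filter (fun y => ρ y < s),
      ((∑ b ∈ univ.filter (fun b => tgt b = x), c b ^ 2) + ∑ b ∈ univ.filter (fun b => src b = x), c b ^ 2) * z x ≤
      ((∑ b ∈ univ.filter (fun b => tgt b = x), c b ^ 2 * z (src b)) + ∑ b ∈ univ.filter (fun b => src b = x), c b ^ 2 * z (tgt b)))
    (x : St) (hx : ρ x < s) {K : ℝ}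
    (hK : ∀ y, ρ y = s → poisson src tgt c (univ.filter (fun y => ρ y < s)) x y ≤ K) :
    z x ≤ K * ∑ y ∈ univ.filter (fun y => ρ y = s), z y := by
  have h1 := subsolution_le_poisson_sum src tgt c (univ.filter (fun y => ρ y < s)) w₀ hw₀0 hw₀ z hz x
  refine h1.trans ?_
  -- termwise: `P·z ≤ [ρ y = s]·K·z` on the exterior `{¬ ρ < s}`
  have hterm : ∀ y ∈ univ.filter (fun y => y ∉ univ.filter (fun y => ρ y < s)),
      poisson src tgt c (univ.filter (fun y => ρ y < s)) x y * z y ≤ if ρ y = s then K * z y else 0 := by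
    intro y hy
    have hy' : ¬ ρ y < s := fun h => (mem_filter.mp hy).2 (mem_filter.mpr ⟨mem_univ _, h⟩)
    by_cases hys : ρ y = s
    · rw [if_pos hys]
      exact mul_le_mul_of_nonneg_right (hK y hys) (hz0 y)
    · rw [if_neg hys, poisson_ball_eq_zero_of_lt_level src tgt c ρ hρ s w₀ hw₀0 hw₀ x y hx (by omega), zero_mul]
  refine (Finset.sum_le_sum hterm).trans (le_of_eq ?_)
  rw [← Finset.sum_filter, Finset.filter_filter, Finset.mul_sum]
  refine Finset.sum_congr ?_ fun _ _ => rfl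
  ext y
  simp only [mem_filter, mem_univ, true_and]
  constructor
  · exact fun h => h.2
  · intro h
    exact ⟨fun h' => by omega, h⟩

end Level

/-! ## §3 Averaging over the radii -/

section Average

variable (D : Finset St) (w₀ : St → ℝ) (hw₀0 : ∀ y, 0 ≤ w₀ y)
    (hw₀ : ∀ x ∈ D, 1 + ((∑ b ∈ univ.filter (fun b => tgt b = x), c b ^ 2 * w₀ (src b)) +
        ∑ b ∈ univ.filter (fun b => src b = x), c b ^ 2 * w₀ (tgt b)) ≤
      ((∑ b ∈ univ.filter (fun b => tgt b = x), c b ^ 2) + ∑ b ∈ univ.filter (fun b => src b = x), c b ^ 2) * w₀ x)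
    {s₁ s₂ : ℕ} (hD : ∀ y, ρ y < s₂ → y ∈ D)
    (z : St → ℝ) (hz0 : ∀ y, 0 ≤ z y)
    (hz : ∀ x ∈ D,
      ((∑ b ∈ univ.filter (fun b => tgt b = x), c b ^ 2) + ∑ b ∈ univ.filter (fun b => src b = x), c b ^ 2) * z x ≤
      ((∑ b ∈ univ.filter (fun b => tgt b = x), c b ^ 2 * z (src b)) + ∑ b ∈ univ.filter (fun b => src b = x), c b ^ 2 * z (tgt b)))
    (x : St) (hx : ρ x < s₁) (K : ℕ → ℝ)
    (hP : ∀ s, s₁ ≤ s → s ≤ s₂ → ∀ y, ρ y = s → poisson src tgt c (univ.filter (fun y => ρ y < s)) x y ≤ K s)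

include hρ hw₀0 hw₀ hD hz0 hz hx hP

/-- **AVERAGING OVER THE RADII.**  Let `D ⊇ C_{s₂}` carry a nonnegative unit supersolution, let `z ≥ 0` satisfy `W·z ≤ Nz` on `D`, let
`ρ x < s₁`, and let the Poisson kernels of the balls `C_s`, `s₁ ≤ s ≤ s₂`, from `x` be bounded by `K_s` on their level sets `{ρ = s}`.
Summing §2 over `s`: `(s₂ + 1 − s₁)·z(x) ≤ Σ_{s = s₁}^{s₂} K_s·Σ_{ρ = s} z`. [folklore] -/
theorem card_mul_le_sum_levels :
    ((s₂ + 1 - s₁ : ℕ) : ℝ) * z x ≤ ∑ s ∈ Finset.Icc s₁ s₂, K s * ∑ y ∈ univ.filter (fun y => ρ y = s), z y := by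
  have hs : ∀ s ∈ Finset.Icc s₁ s₂, z x ≤ K s * ∑ y ∈ univ.filter (fun y => ρ y = s), z y := by
    intro s hs
    have hs' := Finset.mem_Icc.mp hs
    have hsub : ∀ y, ρ y < s → y ∈ D := fun y hy => hD y (by omega)
    exact le_mul_sum_level src tgt c ρ hρ s w₀ hw₀0 (fun y hy => hw₀ y (hsub y (mem_filter.mp hy).2)) z hz0
      (fun y hy => hz y (hsub y (mem_filter.mp hy).2)) x (by omega) (hP s hs'.1 hs'.2)
  calc ((s₂ + 1 - s₁ : ℕ) : ℝ) * z x = ∑ _s ∈ Finset.Icc s₁ s₂, z x := by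
        rw [Finset.sum_const, Nat.card_Icc, nsmul_eq_mul]
    _ ≤ _ := Finset.sum_le_sum hs

/-- **… and with a common bound on the kernels**: if `K_s ≤ K'` for `s₁ ≤ s ≤ s₂` then, the level sets being disjoint,
`(s₂ + 1 − s₁)·z(x) ≤ K'·Σ_{s₁ ≤ ρ ≤ s₂} z`. [folklore] -/
theorem card_mul_le_max_mul_sum {K' : ℝ} (hK' : ∀ s, s₁ ≤ s → s ≤ s₂ → K s ≤ K') :
    ((s₂ + 1 - s₁ : ℕ) : ℝ) * z x ≤ K' * ∑ y ∈ univ.filter (fun y => s₁ ≤ ρ y ∧ ρ y ≤ s₂), z y := by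
  refine (card_mul_le_sum_levels src tgt c ρ hρ D w₀ hw₀0 hw₀ hD z hz0 hz x hx K hP).trans ?_
  have h1 : ∑ s ∈ Finset.Icc s₁ s₂, K s * ∑ y ∈ univ.filter (fun y => ρ y = s), z y ≤
      ∑ s ∈ Finset.Icc s₁ s₂, K' * ∑ y ∈ univ.filter (fun y => ρ y = s), z y :=
    Finset.sum_le_sum fun s hs => mul_le_mul_of_nonneg_right
      (hK' s (Finset.mem_Icc.mp hs).1 (Finset.mem_Icc.mp hs).2) (Finset.sum_nonneg fun y _ => hz0 y)
  refine h1.trans (le_of_eq ?_)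
  rw [← Finset.mul_sum]
  congr 1
  -- the level sets `{ρ = s}`, `s ∈ [s₁, s₂]`, partition `{s₁ ≤ ρ ≤ s₂}`
  rw [← Finset.sum_fiberwise_of_maps_to (s := univ.filter (fun y => s₁ ≤ ρ y ∧ ρ y ≤ s₂)) (t := Finset.Icc s₁ s₂) (g := ρ)
    (fun y hy => Finset.mem_Icc.mpr (mem_filter.mp hy).2)]
  refine Finset.sum_congr rfl fun s hs => Finset.sum_congr ?_ fun _ _ => rfl
  ext y
  simp only [mem_filter, mem_univ, true_and]
  have hs' := Finset.mem_Icc.mp hs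
  constructor
  · intro h; exact ⟨by omega, h⟩
  · intro h; exact h.2

end Average

/-! ## §4 The binder's shape: the L¹ mean-value inequality from a harmonic-measure bound `K₀/s^{d−1}` -/

/-- `⌊s₂/2⌋ + 1 > s₂/2` in `ℝ`. [folklore] -/
theorem half_lt_succ_div (s₂ : ℕ) : (s₂ : ℝ) / 2 < ((s₂ / 2 + 1 : ℕ) : ℝ) := by
  have h : s₂ < 2 * (s₂ / 2 + 1) := by omega
  have h' : (s₂ : ℝ) < 2 * ((s₂ / 2 + 1 : ℕ) : ℝ) := by exact_mod_cast h
  linarith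

include hρ in
/-- **THE L¹ MEAN-VALUE INEQUALITY FROM A HARMONIC-MEASURE BOUND** (the (MV) binder's shape).  On a finite bond structure with weights
`c`, let `ρ : St → ℕ` be 1-Lipschitz along the bonds, `C_s = {ρ < s}`; let `D ⊇ C_{s₂}` carry a nonnegative unit
supersolution (`1 + Nw₀ ≤ W·w₀` on `D`); let `z ≥ 0` satisfy `W·z ≤ Nz` on `D`; let `x` satisfy `ρ x < ⌊s₂/2⌋ + 1`; and assume the
POINTWISE POISSON BOUND `poisson (C_s) x y ≤ K₀/s^{d−1}` for `⌊s₂/2⌋ + 1 ≤ s ≤ s₂` and `ρ y = s` (`K₀ ≥ 0`, `s₂ ≥ 1`, `d ≥ 1`).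
Then `z(x) ≤ (2^d·K₀/s₂^d)·Σ_{ρ ≤ s₂} z`.  Proof: §3 with `K' = K₀/(⌊s₂/2⌋+1)^{d−1} ≤ 2^{d−1}K₀/s₂^{d−1}` and at least
`s₂/2` radii (`s₂ + 1 − (⌊s₂/2⌋+1) ≥ s₂/2`). [folklore] -/
theorem meanValue_of_poisson_bound (D : Finset St) (w₀ : St → ℝ) (hw₀0 : ∀ y, 0 ≤ w₀ y)
    (hw₀ : ∀ x ∈ D, 1 + ((∑ b ∈ univ.filter (fun b => tgt b = x), c b ^ 2 * w₀ (src b)) +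
        ∑ b ∈ univ.filter (fun b => src b = x), c b ^ 2 * w₀ (tgt b)) ≤
      ((∑ b ∈ univ.filter (fun b => tgt b = x), c b ^ 2) + ∑ b ∈ univ.filter (fun b => src b = x), c b ^ 2) * w₀ x)
    {s₂ : ℕ} (hs₂ : 1 ≤ s₂) (hD : ∀ y, ρ y < s₂ → y ∈ D)
    (z : St → ℝ) (hz0 : ∀ y, 0 ≤ z y)
    (hz : ∀ x ∈ D,
      ((∑ b ∈ univ.filter (fun b => tgt b = x), c b ^ 2) + ∑ b ∈ univ.filter (fun b => src b = x), c b ^ 2) * z x ≤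
      ((∑ b ∈ univ.filter (fun b => tgt b = x), c b ^ 2 * z (src b)) + ∑ b ∈ univ.filter (fun b => src b = x), c b ^ 2 * z (tgt b)))
    (x : St) (hx : ρ x < s₂ / 2 + 1) {d : ℕ} (hd : 1 ≤ d) {K₀ : ℝ} (hK₀ : 0 ≤ K₀)
    (hP : ∀ s, s₂ / 2 + 1 ≤ s → s ≤ s₂ → ∀ y, ρ y = s →
      poisson src tgt c (univ.filter (fun y => ρ y < s)) x y ≤ K₀ / (s : ℝ) ^ (d - 1)) :
    z x ≤ 2 ^ d * K₀ / (s₂ : ℝ) ^ d * ∑ y ∈ univ.filter (fun y => ρ y ≤ s₂), z y := by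
  set s₁ := s₂ / 2 + 1 with hs₁
  have hs₁pos : (0 : ℝ) < (s₁ : ℝ) := by positivity
  have hs₂pos : (0 : ℝ) < (s₂ : ℝ) := by exact_mod_cast hs₂
  have hhalf : (s₂ : ℝ) / 2 < (s₁ : ℝ) := half_lt_succ_div s₂
  -- §3 with the common bound `K' = K₀ / s₁^{d-1}`
  have hK' : ∀ s, s₁ ≤ s → s ≤ s₂ → K₀ / (s : ℝ) ^ (d - 1) ≤ K₀ / (s₁ : ℝ) ^ (d - 1) := by
    intro s hs _
    have hs' : (s₁ : ℝ) ≤ s := by exact_mod_cast hs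
    exact div_le_div_of_nonneg_left hK₀ (pow_pos hs₁pos _) (pow_le_pow_left₀ hs₁pos.le hs' _)
  have hmain := card_mul_le_max_mul_sum src tgt c ρ hρ D w₀ hw₀0 hw₀ hD z hz0 hz x hx
    (fun s => K₀ / (s : ℝ) ^ (d - 1)) hP hK'
  -- the number of radii is at least `s₂/2`
  have hcount : (s₂ : ℝ) / 2 ≤ ((s₂ + 1 - s₁ : ℕ) : ℝ) := by
    have h1 : s₁ ≤ s₂ + 1 := by omega
    rw [Nat.cast_sub h1]
    push_cast
    have h2 : ((s₂ / 2 : ℕ) : ℝ) ≤ (s₂ : ℝ) / 2 := by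
      rw [le_div_iff₀ (by norm_num : (0:ℝ) < 2)]
      exact_mod_cast Nat.div_mul_le_self s₂ 2
    rw [hs₁]; push_cast; linarith
  -- the sum over `{s₁ ≤ ρ ≤ s₂}` is at most the sum over `{ρ ≤ s₂}`
  have hsum : ∑ y ∈ univ.filter (fun y => s₁ ≤ ρ y ∧ ρ y ≤ s₂), z y ≤ ∑ y ∈ univ.filter (fun y => ρ y ≤ s₂), z y :=
    Finset.sum_le_sum_of_subset_of_nonneg (fun y hy => mem_filter.mpr ⟨mem_univ _, (mem_filter.mp hy).2.2⟩)
      (fun y _ _ => hz0 y)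
  have hS0 : 0 ≤ ∑ y ∈ univ.filter (fun y => ρ y ≤ s₂), z y := Finset.sum_nonneg fun y _ => hz0 y
  have hK'0 : 0 ≤ K₀ / (s₁ : ℝ) ^ (d - 1) := div_nonneg hK₀ (pow_nonneg hs₁pos.le _)
  -- `K₀/s₁^{d-1} ≤ 2^{d-1} K₀ / s₂^{d-1}`
  have hpow : ((s₂ : ℝ) / 2) ^ (d - 1) ≤ (s₁ : ℝ) ^ (d - 1) := pow_le_pow_left₀ (by positivity) hhalf.le _
  have hK'le : K₀ / (s₁ : ℝ) ^ (d - 1) ≤ K₀ / ((s₂ : ℝ) / 2) ^ (d - 1) :=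
    div_le_div_of_nonneg_left hK₀ (pow_pos (by positivity) _) hpow
  -- assemble: `(s₂/2)·z x ≤ (K₀/(s₂/2)^{d-1})·Σ`
  have h1 : (s₂ : ℝ) / 2 * z x ≤ K₀ / ((s₂ : ℝ) / 2) ^ (d - 1) * ∑ y ∈ univ.filter (fun y => ρ y ≤ s₂), z y :=
    calc (s₂ : ℝ) / 2 * z x ≤ ((s₂ + 1 - s₁ : ℕ) : ℝ) * z x := mul_le_mul_of_nonneg_right hcount (hz0 x)
      _ ≤ K₀ / (s₁ : ℝ) ^ (d - 1) * ∑ y ∈ univ.filter (fun y => s₁ ≤ ρ y ∧ ρ y ≤ s₂), z y := hmain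
      _ ≤ K₀ / ((s₂ : ℝ) / 2) ^ (d - 1) * ∑ y ∈ univ.filter (fun y => ρ y ≤ s₂), z y :=
          mul_le_mul hK'le hsum (Finset.sum_nonneg fun y _ => hz0 y) (div_nonneg hK₀ (pow_nonneg (by positivity) _))
  -- divide by `s₂/2` and rewrite the constant
  have h2 : z x ≤ (K₀ / ((s₂ : ℝ) / 2) ^ (d - 1)) / ((s₂ : ℝ) / 2) * ∑ y ∈ univ.filter (fun y => ρ y ≤ s₂), z y := by
    rw [div_mul_eq_mul_div, le_div_iff₀ (by positivity)]
    linarith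
  refine h2.trans (le_of_eq ?_)
  congr 1
  obtain ⟨k, rfl⟩ : ∃ k, d = k + 1 := ⟨d - 1, by omega⟩
  simp only [Nat.add_sub_cancel]
  have hs₂ne : (s₂ : ℝ) ≠ 0 := hs₂pos.ne'
  rw [div_div, ← pow_succ, div_pow, div_div_eq_mul_div, pow_succ, pow_succ]
  ring

end

end Summit.QuantumFields.BalabanUV.Beta.MeanValueFromPoisson
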